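import Summits.Ventures.PercRepro.RankLevelSetExplicitLin2IndepFloorS
import Summits.Ventures.PercRepro.RankLevelSetExplicitLin2IndepRowSSeventeen

/-!
# PercRepro — THE LEVEL-17 SHARP THEOREM-M ROW AND THE TABLE EXTENDED TO `q = 17` (p4, S4 feed)

`proofs/P4-gen18.md` §6. The first row beyond the quartic / cubic / saturated tables: level `17` for every finite matroid and every
`p ≥ 132 332` (THEOREM U's `q·2^{q+1} + 1 = 4 456 449` was the threshold of record: a cut of 33.7×) — the sharp row
RankLevelSetExplicitLin2IndepRowSSeventeen (`KeyL 17 132332 d` at the 131 072 core coranks, 64 chunks of 2 048) through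
`c025_level_succ_of_keyL_row_tailOpt` on the level-16 row `c025_sixteen_indepS_from_66440`; the table `PfloorLS2` = `PfloorLS`
with the `q = 17` entry, `c025_floorLS2`, `c025_of_window_floorLS2`. Axioms: standard.
-/

open scoped Matroid

namespace PercRepro

namespace ThmN

variable {α : Type}

/-- **THE LEVEL-17 SHARP STEP FROM `132 332`**: level `17` from level `16` at `p − 1` — the row `key_seventeen_indepS_row` at the
optimal-Chernoff tail `132 332` (`D = 17 + 2^17`, `n₀ = 263 421`, `K₀ = 131 106`; the bases `N₁ = P₂ = 132 332`), all by the kernel. -/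
theorem c025_seventeen_indepS_step (hprev : ∀ (M : Matroid α) [M.Finite] (p : ℕ), 132331 ≤ p → RLS M p 16) :
    ∀ (M : Matroid α) [M.Finite] (p : ℕ), 132332 ≤ p → RLS M p 17 :=
  c025_level_succ_of_keyL_row_tailOpt 16 (by norm_num) 132332 132332 132332 le_rfl (by norm_num) (by decide +kernel) le_rfl
    (by norm_num) (by decide +kernel) (by norm_num) (by norm_num) (by decide +kernel) Explicit.key_seventeen_indepS_row hprev

/-- **THE LEVEL-17 SHARP ROW FROM `132 332`**: C-025 at level `17` for every finite matroid and every `p ≥ 132 332` (was THEOREM U's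
`4 456 449`) — the step on the level-16 row `c025_sixteen_indepS_from_66440` (`66 440 ≤ p`) at `p − 1`. -/
theorem c025_seventeen_indepS_from_132332 (M : Matroid α) [M.Finite] (p : ℕ) (hp : 132332 ≤ p) : RLS M p 17 :=
  c025_seventeen_indepS_step (fun M' _ p' hp' => c025_sixteen_indepS_from_66440 M' p' (by omega)) M p hp

/-- The same in the literal `C025` body for every finite matroid and every `p ≥ 132 332`. -/
theorem c025_seventeen_indepS_from_132332' (M : Matroid α) [M.Finite] (p : ℕ) (hp : 132332 ≤ p) :
    phiK p 17 * ({A : Set α | A ⊆ M.E ∧ M.eRk A = (p : ℕ∞) ∧ M.eRk (M.E \ A) = (17 : ℕ∞)}.ncard : ℚ) ≤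
      ({A : Set α | A ⊆ M.E ∧ (17 : ℕ∞) < M.eRk A ∧ M.eRk A < (p : ℕ∞)}.ncard : ℚ) :=
  c025_seventeen_indepS_from_132332 M p hp

/-- **THE SHARP TABLE TO `q = 17`**: `PfloorLS` with `PfloorLS2 17 = 132 332`. -/
def PfloorLS2 (q : ℕ) : ℕ := if q = 17 then 132332 else PfloorLS q

/-- `PfloorLS2 q ≤ PfloorLS q` at every level (`PfloorLS 17 = 17·2^18 + 1`). -/
theorem PfloorLS2_le_PfloorLS (q : ℕ) : PfloorLS2 q ≤ PfloorLS q := by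
  unfold PfloorLS2
  split_ifs with h17
  · subst h17; unfold PfloorLS; norm_num
  · exact le_rfl

/-- `PfloorLS2 q ≤ q·2^{q+1} + 1` at every level. -/
theorem PfloorLS2_le (q : ℕ) : PfloorLS2 q ≤ q * 2 ^ (q + 1) + 1 := (PfloorLS2_le_PfloorLS q).trans (PfloorLS_le q)

/-- **C-025 AT EVERY LEVEL `q ≥ 7` FROM THE SHARP TABLE TO `q = 17`**. -/
theorem c025_floorLS2 (q : ℕ) (hq : 7 ≤ q) (M : Matroid α) [M.Finite] (p : ℕ) (hp : PfloorLS2 q ≤ p) : RLS M p q := by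
  unfold PfloorLS2 at hp
  split_ifs at hp with h17
  · subst h17; exact c025_seventeen_indepS_from_132332 M p hp
  · exact c025_floorLS q hq M p hp

/-- **THE CRUX IS ITS WINDOWS BELOW THE SHARP TABLE TO `q = 17`**. -/
theorem c025_of_window_floorLS2
    (hwin : ∀ {α : Type} (M : Matroid α) [M.Finite] (p q : ℕ), q + 2 ≤ p → p < PfloorLS2 q →
      phiK p q * ({A : Set α | A ⊆ M.E ∧ M.eRk A = (p : ℕ∞) ∧ M.eRk (M.E \ A) = (q : ℕ∞)}.ncard : ℚ) ≤
        ({A : Set α | A ⊆ M.E ∧ (q : ℕ∞) < M.eRk A ∧ M.eRk A < (p : ℕ∞)}.ncard : ℚ)) : C025 := by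
  refine c025_of_window_floorLS ?_
  intro β M _ p q hpq hlt
  rcases Nat.lt_or_ge p (PfloorLS2 q) with h | h
  · exact hwin M p q hpq h
  · rcases Nat.lt_or_ge q 7 with hq | hq
    · exfalso
      have : PfloorLS2 q = PfloorLS q := by
        unfold PfloorLS2
        split_ifs <;> omega
      omega
    · exact c025_floorLS2 q hq M p h

/-- `PfloorLS2 17 = 132 332`, `PfloorLS2 16 = 66 440`. -/
theorem PfloorLS2_values : PfloorLS2 17 = 132332 ∧ PfloorLS2 16 = 66440 := by
  unfold PfloorLS2 PfloorLS; norm_num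

end ThmN

end PercRepro
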